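import Mathlib
import Summits.ValiantsHypothesis.ValiantsHypothesis.Theorems.GrenetZeonDualUnipotentThreeHalvesWordFlagDuality

/-!
# Corner transfer (val-idea-27 g7 — row F2 of `MEMO-idea27-g7-weight-lens.md` §4; crux `GrenetZeon.DualUnipotentThreeHalves`
# = stmt-ValiantsHypothesis-24318; bears on MassCut (c) `LongMassSlowLaw` via the FLAG FLOOR on the irreducible constituent W(b))

HONEST FRAMING. `VP ≠ VNP` is NOT proved; 24318 / S3 / R2ᵖ / IRR / RED / MassCut (b)(c) are OPEN. This file proves ONE explicit matrix
identity and its non-vanishing corollary — step (4) of the paper FLAG FLOOR (memo §2): no law, no `sorry`.  rev 2: + the TREE-CURRENCY corollaries `not_wordTame_corner` / `not_flagAdaptedUpTo_corner` (steps (2)+(4)).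

CONTENT. Over any commutative ring, for `u` supported on ONE anti-diagonal `d ≥ 1` of `M_m` (`antiDiag d u`: entry `(j+d, j) = u j`) put
`Q := [antiDiag d u, J_m]`. Then
* `comm_apply`     : `Q` is supported on the anti-diagonal `d − 1`, entry `(j+d−1, j) = δ_j := u_{j−1} − u_j` (boundary terms guarded);
* `Jpow_mul_comm`  : `J^{d−1} · Q = diagonal ε` with `ε_j = δ_j` (for `j + d ≤ m`, else `0`);
* `cornerWord_apply` : the WORD `W_t := Q · (J^{d−1} · Q)^t` (t+1 letters `Q`, t(d−1) letters `J`) has entries `W_t i j = Q i j · ε_j^t`, i.e.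
                     `(δ_j)^{t+1}` on the anti-diagonal `d − 1` and `0` elsewhere;
* ★ `cornerTransfer_ne_zero` : over a domain, if `u c ≠ 0` for some admissible column (`c + d < m`) then `W_t ≠ 0` for EVERY `t`
                     (at the least support column `c⋆`, `δ_{c⋆} = −u_{c⋆}`).
USE (memo §2 step (4)). At the point `P = J` of the W(b)-pencil with top `Q = [u,J]`, `u ∈ 𝒮_d ∖ 0`, the words `W_t` are non-zero words of
length `td + 1` with `t + 1` tops, so any flag/word certificate through that direction has budget `k ≥ ⌊(n−2)/d⌋ + 1` (step (2): #tops of a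
non-zero word of length ≤ n−1 is ≤ flagDeg). `Jm` is verbatim `GaugeRow.Jm` (crux workfiles are not importable from one another).
-/

set_option linter.dupNamespace false
set_option autoImplicit false

namespace Summit.ValiantsHypothesis.ValiantsHypothesis.Cruxes.DualUnipotentThreeHalves.CornerTransfer

open Matrix

variable {S : Type*} {m : ℕ}

/-- `J_m = Σ_s E_{s,s+1}` (verbatim `GaugeRow.Jm`). -/
def Jm (m : ℕ) [Zero S] [One S] : Matrix (Fin m) (Fin m) S := fun i j => if (j : ℕ) = (i : ℕ) + 1 then 1 else 0

/-- Entries of the powers of `J_m`: `(J^k) i j = [j = i + k]`. -/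
theorem Jm_pow_apply [Semiring S] (k : ℕ) (i j : Fin m) :
    ((Jm m : Matrix (Fin m) (Fin m) S) ^ k) i j = if (j : ℕ) = (i : ℕ) + k then 1 else 0 := by
  induction k generalizing i j with
  | zero =>
      rw [pow_zero, Matrix.one_apply]
      by_cases h : i = j
      · subst h; simp
      · have h' : ¬ ((j : ℕ) = (i : ℕ) + 0) := by
          intro e; apply h; exact Fin.ext (by omega)
        rw [if_neg h, if_neg h']
  | succ k ih =>
      rw [pow_succ, Matrix.mul_apply]
      by_cases hlt : (i : ℕ) + k < m
      · let l₀ : Fin m := ⟨(i : ℕ) + k, hlt⟩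
        rw [Finset.sum_eq_single l₀]
        · rw [ih i l₀]
          have e0 : ((l₀ : ℕ) = (i : ℕ) + k) := rfl
          rw [if_pos e0, one_mul]
          simp only [Jm, l₀]
          split_ifs with h1 h2 <;> first | rfl | (exfalso; omega)
        · intro l _ hl
          rw [ih i l]
          have : ¬ ((l : ℕ) = (i : ℕ) + k) := by
            intro e; apply hl; exact Fin.ext (by simp [l₀, e])
          rw [if_neg this, zero_mul]
        · intro h; exact absurd (Finset.mem_univ l₀) h
      · rw [Finset.sum_eq_zero]
        · have : ¬ ((j : ℕ) = (i : ℕ) + (k + 1)) := by have := j.isLt; omega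
          rw [if_neg this]
        · intro l _
          rw [ih i l]
          have : ¬ ((l : ℕ) = (i : ℕ) + k) := by have := l.isLt; omega
          rw [if_neg this, zero_mul]

/-- The anti-diagonal-`d` matrix with column values `u`: entry `(j + d, j) = u j`, all other entries `0`. -/
def antiDiag [Zero S] (d : ℕ) (u : Fin m → S) : Matrix (Fin m) (Fin m) S :=
  fun i j => if (i : ℕ) = (j : ℕ) + d then u j else 0

/-- `δ_j = u_{j−1} − u_j`, with the boundary guards (`u_{−1} := 0`; the `u_j` term is present only if the row `j + d` exists). -/
def delta [Ring S] (d : ℕ) (u : Fin m → S) (j : Fin m) : S :=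
  (if h : 0 < (j : ℕ) then u ⟨(j : ℕ) - 1, by omega⟩ else 0) - (if (j : ℕ) + d < m then u j else 0)

/-- `(antiDiag d u · J) i j = [i + 1 = j + d ∧ 0 < j] · u_{j−1}`. -/
theorem antiDiag_mul_Jm_apply [Ring S] (d : ℕ) (u : Fin m → S) (i j : Fin m) :
    (antiDiag d u * (Jm m : Matrix (Fin m) (Fin m) S)) i j =
      if (i : ℕ) + 1 = (j : ℕ) + d then (if h : 0 < (j : ℕ) then u ⟨(j : ℕ) - 1, by omega⟩ else 0) else 0 := by
  rw [Matrix.mul_apply]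
  by_cases hj : 0 < (j : ℕ)
  · let l₀ : Fin m := ⟨(j : ℕ) - 1, by omega⟩
    rw [Finset.sum_eq_single l₀]
    · simp only [antiDiag, Jm, l₀, dif_pos hj]
      have e1 : ((j : ℕ) = (j : ℕ) - 1 + 1) := by omega
      rw [if_pos e1, mul_one]
      by_cases hi : (i : ℕ) + 1 = (j : ℕ) + d
      · rw [if_pos (by omega), if_pos hi]
      · rw [if_neg (by omega), if_neg hi]
    · intro l _ hl
      simp only [antiDiag, Jm]
      have : ¬ ((j : ℕ) = (l : ℕ) + 1) := by
        intro e; apply hl; exact Fin.ext (by simp [l₀]; omega)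
      rw [if_neg this, mul_zero]
    · intro h; exact absurd (Finset.mem_univ l₀) h
  · rw [Finset.sum_eq_zero]
    · rw [dif_neg hj]; split_ifs <;> rfl
    · intro l _
      simp only [antiDiag, Jm]
      have : ¬ ((j : ℕ) = (l : ℕ) + 1) := by omega
      rw [if_neg this, mul_zero]

/-- `(J · antiDiag d u) i j = [i + 1 = j + d ∧ j + d < m] · u_j`. -/
theorem Jm_mul_antiDiag_apply [Ring S] (d : ℕ) (u : Fin m → S) (i j : Fin m) :
    ((Jm m : Matrix (Fin m) (Fin m) S) * antiDiag d u) i j = if (i : ℕ) + 1 = (j : ℕ) + d then (if (j : ℕ) + d < m then u j else 0) else 0 := by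
  rw [Matrix.mul_apply]
  by_cases hi : (i : ℕ) + 1 < m
  · let l₀ : Fin m := ⟨(i : ℕ) + 1, hi⟩
    rw [Finset.sum_eq_single l₀]
    · have e0 : ((l₀ : ℕ) = (i : ℕ) + 1) := rfl
      simp only [antiDiag, Jm, e0, if_true, one_mul]
      by_cases e : (i : ℕ) + 1 = (j : ℕ) + d
      · have hjd : (j : ℕ) + d < m := by omega
        rw [if_pos e, if_pos e, if_pos hjd]
      · rw [if_neg e, if_neg e]
    · intro l _ hl
      simp only [antiDiag, Jm]
      have : ¬ ((l : ℕ) = (i : ℕ) + 1) := by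
        intro e; apply hl; exact Fin.ext (by simp [l₀, e])
      rw [if_neg this, zero_mul]
    · intro h; exact absurd (Finset.mem_univ l₀) h
  · rw [Finset.sum_eq_zero]
    · by_cases e : (i : ℕ) + 1 = (j : ℕ) + d
      · rw [if_pos e, if_neg (by omega)]
      · rw [if_neg e]
    · intro l _
      simp only [antiDiag, Jm]
      have : ¬ ((l : ℕ) = (i : ℕ) + 1) := by have := l.isLt; omega
      rw [if_neg this, zero_mul]

/-- `Q := [antiDiag d u, J_m]`. -/
def comm [Ring S] (d : ℕ) (u : Fin m → S) : Matrix (Fin m) (Fin m) S :=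
  antiDiag d u * (Jm m : Matrix (Fin m) (Fin m) S) - (Jm m : Matrix (Fin m) (Fin m) S) * antiDiag d u

/-- `Q = [antiDiag d u, J]` lives on the anti-diagonal `d − 1` with entries `δ_j`. -/
theorem comm_apply [Ring S] (d : ℕ) (u : Fin m → S) (i j : Fin m) :
    comm d u i j = if (i : ℕ) + 1 = (j : ℕ) + d then delta d u j else 0 := by
  rw [comm, Matrix.sub_apply, antiDiag_mul_Jm_apply, Jm_mul_antiDiag_apply, delta]
  split_ifs <;> simp

/-- `ε_j := δ_j` if the row `j + d − 1` exists (`j + d ≤ m`), else `0`. -/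
def eps [Ring S] (d : ℕ) (u : Fin m → S) (j : Fin m) : S := if (j : ℕ) + d ≤ m then delta d u j else 0

/-- `J^{d−1} · Q = diagonal ε` (`d ≥ 1`). -/
theorem Jpow_mul_comm [Ring S] {d : ℕ} (hd : 1 ≤ d) (u : Fin m → S) :
    (Jm m : Matrix (Fin m) (Fin m) S) ^ (d - 1) * comm d u = Matrix.diagonal (eps d u) := by
  ext a j
  rw [Matrix.mul_apply, Matrix.diagonal_apply]
  by_cases ha : (a : ℕ) + (d - 1) < m
  · let l₀ : Fin m := ⟨(a : ℕ) + (d - 1), ha⟩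
    rw [Finset.sum_eq_single l₀]
    · rw [Jm_pow_apply, comm_apply]
      have e0 : ((l₀ : ℕ) = (a : ℕ) + (d - 1)) := rfl
      simp only [e0, if_true, one_mul, eps]
      by_cases e : a = j
      · subst e
        have h1 : (a : ℕ) + (d - 1) + 1 = (a : ℕ) + d := by omega
        have h2 : (a : ℕ) + d ≤ m := by omega
        rw [if_pos h1, if_pos rfl, if_pos h2]
      · have : ¬ ((a : ℕ) + (d - 1) + 1 = (j : ℕ) + d) := by
          intro h; apply e; exact Fin.ext (by omega)
        rw [if_neg this, if_neg e]
    · intro l _ hl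
      rw [Jm_pow_apply]
      have : ¬ ((l : ℕ) = (a : ℕ) + (d - 1)) := by
        intro e; apply hl; exact Fin.ext (by simp [l₀, e])
      rw [if_neg this, zero_mul]
    · intro h; exact absurd (Finset.mem_univ l₀) h
  · rw [Finset.sum_eq_zero]
    · by_cases e : a = j
      · subst e; rw [if_pos rfl, eps, if_neg (by omega)]
      · rw [if_neg e]
    · intro l _
      rw [Jm_pow_apply]
      have : ¬ ((l : ℕ) = (a : ℕ) + (d - 1)) := by have := l.isLt; omega
      rw [if_neg this, zero_mul]

/-- THE WORD `W_t := Q · (J^{d−1} · Q)^t` — `t + 1` letters `Q`, `t(d−1)` letters `J`. -/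
def cornerWord [Ring S] (d : ℕ) (u : Fin m → S) (t : ℕ) : Matrix (Fin m) (Fin m) S :=
  comm d u * ((Jm m : Matrix (Fin m) (Fin m) S) ^ (d - 1) * comm d u) ^ t

/-- Closed form: `W_t i j = Q i j · ε_j^t`. -/
theorem cornerWord_apply [CommRing S] {d : ℕ} (hd : 1 ≤ d) (u : Fin m → S) (t : ℕ) (i j : Fin m) :
    cornerWord d u t i j = (if (i : ℕ) + 1 = (j : ℕ) + d then delta d u j else 0) * (eps d u j) ^ t := by
  rw [cornerWord, Jpow_mul_comm hd, Matrix.diagonal_pow, Matrix.mul_diagonal, comm_apply, Pi.pow_apply]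

/-- On the anti-diagonal `d − 1` the word has entry `δ_j^{t+1}`. -/
theorem cornerWord_apply_diag [CommRing S] {d : ℕ} (hd : 1 ≤ d) (u : Fin m → S) (t : ℕ) (i j : Fin m) (hij : (i : ℕ) + 1 = (j : ℕ) + d) :
    cornerWord d u t i j = (delta d u j) ^ (t + 1) := by
  rw [cornerWord_apply hd, if_pos hij, eps, if_pos (by have := i.isLt; omega), pow_succ, mul_comm]

/-- ★ CORNER TRANSFER (memo §2 step (4)): over a domain, if `u` has a non-zero ADMISSIBLE column (`c + d < m`, i.e. the entry `(c+d, c)` exists)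
then every word `W_t = Q (J^{d−1} Q)^t` is non-zero — at the least support column `c⋆` its entry `(c⋆ + d − 1, c⋆)` is `(−u_{c⋆})^{t+1}`. -/
theorem cornerTransfer_ne_zero [CommRing S] [IsDomain S] {d : ℕ} (hd : 1 ≤ d) {u : Fin m → S}
    (hu : ∃ c : Fin m, (c : ℕ) + d < m ∧ u c ≠ 0) (t : ℕ) : cornerWord d u t ≠ 0 := by
  classical
  obtain ⟨c, hcd, hc⟩ := hu
  -- the least support column
  let T : Finset (Fin m) := Finset.univ.filter (fun c' => u c' ≠ 0)
  have hT : T.Nonempty := ⟨c, by simp [T, hc]⟩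
  let c₀ : Fin m := T.min' hT
  have hc₀mem : c₀ ∈ T := Finset.min'_mem T hT
  have hc₀ : u c₀ ≠ 0 := by simpa [T] using hc₀mem
  have hle : c₀ ≤ c := Finset.min'_le T c (by simp [T, hc])
  have hc₀d : (c₀ : ℕ) + d < m := by have : (c₀ : ℕ) ≤ (c : ℕ) := hle; omega
  have hbelow : ∀ c' : Fin m, c' < c₀ → u c' = 0 := by
    intro c' hlt
    by_contra hne
    have : c₀ ≤ c' := Finset.min'_le T c' (by simp [T, hne])
    exact absurd hlt (not_lt.mpr this)
  -- δ_{c₀} = −u_{c₀}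
  have hdelta : delta d u c₀ = - u c₀ := by
    rw [delta, if_pos hc₀d]
    by_cases h0 : 0 < (c₀ : ℕ)
    · rw [dif_pos h0, hbelow ⟨(c₀ : ℕ) - 1, by omega⟩ (by rw [Fin.lt_def]; simp; omega)]
      ring
    · rw [dif_neg h0]; ring
  -- the entry (c₀ + d − 1, c₀)
  let i₀ : Fin m := ⟨(c₀ : ℕ) + d - 1, by omega⟩
  intro hW
  have h := congrFun (congrFun hW i₀) c₀
  rw [Matrix.zero_apply, cornerWord_apply_diag hd u t i₀ c₀ (by simp [i₀]; omega), hdelta] at h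
  exact hc₀ (neg_eq_zero.mp (pow_eq_zero_iff (Nat.succ_ne_zero t) |>.mp h))

/-- The matrices `antiDiag d u` with `u` supported on hook columns are hook-supported (memo: `u ∈ 𝒮_d ⊆ 𝒳₁`); recorded for the reader:
`antiDiag d u · antiDiag d u' = 0` whenever `d ≥ 1` and … — not needed here. What IS used downstream is only `cornerTransfer_ne_zero`. -/
theorem antiDiag_apply_ne_zero [Zero S] (d : ℕ) (u : Fin m → S) (i j : Fin m) (h : antiDiag d u i j ≠ 0) :
    (i : ℕ) = (j : ℕ) + d ∧ u j ≠ 0 := by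
  simp only [antiDiag] at h
  by_cases e : (i : ℕ) = (j : ℕ) + d
  · exact ⟨e, by rwa [if_pos e] at h⟩
  · exact absurd (if_neg e) h

/-! ## Tree currency: no `WordTame` / `FlagAdaptedUpTo` certificate of budget `k ≤ (n−2)/d` through the corner direction (steps (2)+(4)) -/

section TreeCurrency

open MvPolynomial
open Summit.ValiantsHypothesis.ValiantsHypothesis.Theorems.GrenetZeon.RadicalSplit (word WordTame FlagAdaptedUpTo wordTame_of_flagAdaptedUpTo)

/-- The letter list of `W_t`: `true :: (false^{d−1} true)^t` (`true ↦ T₁ = Q`, `false ↦ T₀ = J`, the convention of `RadicalSplit.word`). -/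
def cornerList (d t : ℕ) : List Bool := true :: (List.replicate t (List.replicate (d - 1) false ++ [true])).flatten

theorem cornerList_succ (d t : ℕ) : cornerList d (t + 1) = cornerList d t ++ (List.replicate (d - 1) false ++ [true]) := by
  simp [cornerList, List.replicate_succ']

theorem word_append (T₀ T₁ : Matrix (Fin m) (Fin m) ℂ) (w₁ w₂ : List Bool) :
    word T₀ T₁ (w₁ ++ w₂) = word T₀ T₁ w₁ * word T₀ T₁ w₂ := by
  simp [word, List.map_append, List.prod_append]

theorem word_block (T₀ T₁ : Matrix (Fin m) (Fin m) ℂ) (d : ℕ) :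
    word T₀ T₁ (List.replicate (d - 1) false ++ [true]) = T₀ ^ (d - 1) * T₁ := by
  simp [word, List.map_append, List.prod_append, List.map_replicate, List.prod_replicate]

theorem word_cornerList (T₀ T₁ : Matrix (Fin m) (Fin m) ℂ) (d t : ℕ) :
    word T₀ T₁ (cornerList d t) = T₁ * (T₀ ^ (d - 1) * T₁) ^ t := by
  induction t with
  | zero => simp [cornerList, word]
  | succ t ih => rw [cornerList_succ, word_append, ih, word_block, pow_succ, Matrix.mul_assoc]

theorem count_true_cornerList (d t : ℕ) : (cornerList d t).count true = t + 1 := by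
  induction t with
  | zero => simp [cornerList]
  | succ t ih => rw [cornerList_succ, List.count_append, ih]; simp [List.count_replicate]

theorem count_false_cornerList (d t : ℕ) : (cornerList d t).count false = t * (d - 1) := by
  induction t with
  | zero => simp [cornerList]
  | succ t ih => rw [cornerList_succ, List.count_append, ih]; simp; ring

/-- ★ STEPS (2)+(4) IN THE TREE'S WORD CURRENCY: at the point `T₀ = J` with top `T₁ = [antiDiag d u, J]` (u with a non-zero admissible column),
NO word-tame certificate has budget `k` with `k·d + 2 ≤ n` — the word `W_k` (k+1 tops, length kd+1 ≤ n−1) is non-zero. -/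
theorem not_wordTame_corner {d : ℕ} (hd : 1 ≤ d) {u : Fin m → ℂ} (hu : ∃ c : Fin m, (c : ℕ) + d < m ∧ u c ≠ 0)
    {n k : ℕ} (hk : k * d + 2 ≤ n) : ¬ WordTame n k (Jm m) (comm d u) := by
  rintro ⟨r, c, Θ, hc, hdiv, hw⟩
  have hne : word (Jm m) (comm d u) (cornerList d k) ≠ 0 := by
    rw [word_cornerList]; exact cornerTransfer_ne_zero hd hu k
  have h := hw _ hne
  rw [count_true_cornerList, count_false_cornerList] at h
  obtain ⟨d', rfl⟩ : ∃ d', d = d' + 1 := ⟨d - 1, by omega⟩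
  have hsub : d' + 1 - 1 = d' := by omega
  rw [hsub] at h
  -- (c + r)(k + 1) ≤ Θ + r(n − 1)
  have hkey : (k + 1) * (c + r) ≤ Θ + r * (n - 1) := by
    have h1 : r * (k * d') + r * (k + 1) = r * (k * (d' + 1) + 1) := by ring
    have h2 : r * (k * (d' + 1) + 1) ≤ r * (n - 1) := Nat.mul_le_mul_left r (by omega)
    nlinarith
  have := (Nat.le_div_iff_mul_le (by omega : 0 < c + r)).mpr hkey
  omega

/-- The LINE MATRIX `J + s·Q` as a matrix over `ℂ[s] = MvPolynomial (Fin 1) ℂ`. -/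
noncomputable def cornerLine (d : ℕ) (u : Fin m → ℂ) : Matrix (Fin m) (Fin m) (MvPolynomial (Fin 1) ℂ) :=
  (Jm m : Matrix (Fin m) (Fin m) ℂ).map C + (X 0 : MvPolynomial (Fin 1) ℂ) • (comm d u).map C

theorem cornerLine_coeff_zero (d : ℕ) (u : Fin m → ℂ) : (cornerLine d u).map (coeff 0) = Jm m := by
  ext i j
  simp [cornerLine, Matrix.map_apply, Matrix.add_apply, Matrix.smul_apply, coeff_C, coeff_X_mul', smul_eq_mul]

theorem cornerLine_coeff_one (d : ℕ) (u : Fin m → ℂ) : (cornerLine d u).map (coeff (Finsupp.single 0 1)) = comm d u := by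
  ext i j
  simp [cornerLine, Matrix.map_apply, Matrix.add_apply, Matrix.smul_apply, coeff_C, coeff_X_mul', smul_eq_mul,
    Finsupp.single_eq_zero, eq_comm]

/-- ★★ STEPS (2)+(4) IN THE TREE'S FLAG CURRENCY: the line `J + s·[antiDiag d u, J]` (the W(b)-pencil at the point `x₀ = 1, x′ = 0` in the corner
direction `u ∈ 𝒮_d`) admits NO `FlagAdaptedUpTo m k n` certificate with `k·d + 2 ≤ n` — every flag certificate through this direction has budget
`k ≥ ⌊(n − 2)/d⌋ + 1`.  (By ✓ `wordTame_of_flagAdaptedUpTo` + `not_wordTame_corner`.) -/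
theorem not_flagAdaptedUpTo_corner {d : ℕ} (hd : 1 ≤ d) {u : Fin m → ℂ} (hu : ∃ c : Fin m, (c : ℕ) + d < m ∧ u c ≠ 0)
    {n k : ℕ} (hk : k * d + 2 ≤ n) : ¬ FlagAdaptedUpTo m k n (cornerLine d u) := by
  intro h
  have hkn : k + 2 ≤ n := by nlinarith
  have hw := wordTame_of_flagAdaptedUpTo (cornerLine d u) hkn h
  rw [cornerLine_coeff_zero, cornerLine_coeff_one] at hw
  exact not_wordTame_corner hd hu hk hw

end TreeCurrency

/-- Sanity instance (m = 6, d = 3, u = e₀ ∈ ℤ: the corner entry E_{3,0} of the hook block of W(6), h = 4): every word is non-zero. -/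
example (t : ℕ) : cornerWord (m := 6) 3 (fun j => if (j : ℕ) = 0 then (1 : ℤ) else 0) t ≠ 0 :=
  cornerTransfer_ne_zero (by norm_num) ⟨⟨0, by norm_num⟩, by norm_num, by simp⟩ t

end Summit.ValiantsHypothesis.ValiantsHypothesis.Cruxes.DualUnipotentThreeHalves.CornerTransfer
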